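import Literature.Analysis.InnerProduct.HilbertComplexMaps
import Literature.Analysis.InnerProduct.HilbertComplexDualFredholm
import HarnessLib

/-!
# Isomorphic Hilbert complexes have isomorphic cohomology, reduced cohomology and harmonic spaces — the geometric
# and analytic Betti numbers are invariants (Brüning–Lesch 1992, Cor 2.19) — and Poincaré duality: an isomorphism
# onto the dual complex gives `Ker T ≅ Ker S*`, `p₀ = p₂`, and, when unitary, `g(𝔥) = 𝔥` (Lemma 2.16)

Layer `Literature/Analysis/InnerProduct`, namespace `Literature.Analysis.InnerProduct`; sequel BY NAME of
`HilbertComplexMaps.lean` (row g34-#3: `apply_mem_pmapKer_of_map`, `exists_cohomologyMap`,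
`cohomologyMap_bijective_of_homotopyEquiv`, `exists_reducedCohomologyMap`, `reducedCohomologyMap_comp`,
`exists_quotientRangeMap`, `quotientRangeMap_comp`, `harmonicMap_comp`, `harmonicMap_id`, `map_harmonic_eq_of_inner_map`),
`HilbertComplexDualFredholm.lean` (row g34-#2: `harmonic_dual_eq`, `finrank_pmapKer_adjoint_eq_finrank_quotient_range`),
`HilbertComplexHarmonicCohomology.lean` (`bijective_mkQ_comp_inclusion_harmonic`, the Hodge isomorphism
`𝔥 ≅ Ker S / cl Im T`) and `ClosedDenselyDefinedHilbertComplex.lean` (`dense_adjoint_domain_of_isClosed`). Lane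
`lit-hodgefound` (Track 2 foundations library), prover seat `lit-hodgefound-p06` (generation 34), self-proposed row
g34-#6. THEOREMS ONLY (no definition, no instance, no named fact). Conventions as in row g34-#3: a map of complexes
`(E, F, G; T, S) → (E′, F′, G′; T′, S′)` is a triple of bounded maps `g_E, g_F, g_G` with the hypotheses `hgT`, `hgS`;
an isomorphism of complexes is such a map together with a map `k_E, k_F, k_G` the other way (hypotheses `hkT`,
`hkS`) with `k ∘ g = id` and `g ∘ k = id` pointwise (`hkg_E`, …, `hgk_G`). Poincaré duality data for the short complex
`0 → E →T F →S G → 0` is a map `g₀ : E → G`, `g₁ : F → F`, `g₂ : G → E` to the dual complex `0 → G →S* F →T* E → 0`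
((2.48a)–(2.48b): `S*g₀ = g₁T` on `D(T)`, `T*g₁ = g₂S` on `D(S)`), an isomorphism when it has an inverse map
`k₀ : G → E`, `k₁ : F → F`, `k₂ : E → G` of complexes from the dual back.

## Source, verbatim

J. Brüning, M. Lesch, *Hilbert complexes*, J. Funct. Anal. 108 (1992), §2 pp. 95, 102–104 (held text
`paper:doi-10-1016-0022-1236-92-90147-b`, p0008, p0015–p0017):

"LEMMA 2.7. … If `g_i` is unitary then so are `g_{i*}`, `ĝ_i`, and `g_i^j`. … In particular, the dimension of `𝓗̂_i`
is invariant under complex isomorphisms. … Next we want to introduce the notion of Poincaré duality for Hilbert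
complexes. We say that a Hilbert complex `(𝒟, D)` satisfies Poincaré duality if there is an isomorphism of Hilbert
complexes, `g`, from `(𝒟, D)` to the dual complex `(𝒟*, D*)`. LEMMA 2.16. The Hilbert complex `(𝒟, D)` satisfies
Poincaré duality if and only if there are invertible bounded linear maps `g_i : H_i → H_{N−i}` satisfying
`g_i(𝒟_i) = 𝒟*_{N−i−1}` (2.48a), `D*_{N−i−1} ∘ g_i = g_{i+1} ∘ D_i` (2.48b). `g` induces isomorphisms
`ĝ_i : 𝓗̂_i → 𝓗̂_{N−i}` (2.49). If, moreover, `(𝒟, D)` is Fredholm `g` induces also isomorphisms `g_{i*} : H_i →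
H_{N−i}`. Proof. The first assertion follows immediately from the definitions (2.6) and (2.7a), (2.7b). The second
assertion is a consequence of Lemma 2.7 and (2.8b). The last assertion follows from Corollary 2.6. …
COROLLARY 2.19. Let `(𝒟, D)` be a Hilbert complex. Then any isomorphic Hilbert complex, `(𝒟′, D′)`, has the same
analytic and geometric Betti numbers as `(𝒟, D)`."

Here `N = 2`, `H_0 = E`, `H_1 = F`, `H_2 = G`; `𝓗̂_0 = Ker T`, `𝓗̂_1 = 𝔥 = Ker S ∩ Ker T*`, `𝓗̂_2 = Ker S*`; the dual
complex has `𝓗̂*_0 = Ker S*`, `𝓗̂*_1 = Ker T* ∩ Ker S** = 𝔥`, `𝓗̂*_2 = Ker T** = Ker T`; the geometric Betti numbers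
are `p₀ = dim Ker T`, `p₁ = dim Ker S / Im T`, `p₂ = dim G / Im S`.

## What is proved (all over `𝕜 = ℝ` or `ℂ`)

* §1 **Corollary 2.19** for an isomorphism of short complexes: `nonempty_pmapKer_linearEquiv_of_iso` /
  **`finrank_pmapKer_eq_of_iso`** (`Ker T ≅ Ker T′`, degree `0`), **`cohomologyMap_bijective_of_iso`** /
  **`finrank_cohomology_eq_of_iso`** (`Ker S / Im T ≅ Ker S′ / Im T′`), `reducedCohomologyMap_bijective_of_iso` /
  `finrank_reducedCohomology_eq_of_iso`, **`finrank_harmonic_eq_of_iso`** ("the dimension of `𝓗̂_i` is invariant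
  under complex isomorphisms"), **`harmonicMap_bijective_of_iso`** (`ĝ : 𝔥 → 𝔥′` is bijective),
  `quotientRangeMap_bijective_of_iso` / `finrank_quotient_range_eq_of_iso` (`G / Im S ≅ G′ / Im S′`, degree `2`).
* §2 **Lemma 2.16 (Poincaré duality)**: `apply_mem_pmapKer_adjoint_of_poincareDuality` (`g₀(Ker T) ⊆ Ker S*`,
  (2.49) in degree `0`), **`finrank_pmapKer_eq_finrank_pmapKer_adjoint_of_poincareDuality`** (`dim Ker T = dim Ker S*`
  for a Poincaré duality isomorphism), **`finrank_pmapKer_eq_finrank_quotient_range_of_poincareDuality`**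
  ("`g_{i*} : H_i → H_{N−i}`" in the Fredholm case: `p₀ = p₂`), `harmonicMap_bijective_of_poincareDuality`
  (`ĝ₁ : 𝔥 → 𝓗̂*_1` bijective), and the unitary case **`map_harmonic_eq_harmonic_of_poincareDuality`** (`g₁(𝔥) = 𝔥`
  when `g₁` preserves inner products and carries `Ker S` onto `Ker T*`, `cl Im T` onto `cl Im S*`).

## References

* [BruningLesch1992] J. Brüning, M. Lesch, *Hilbert complexes*, J. Funct. Anal. 108 (1992) 88–132, §2 Lemma 2.7,
  Lemma 2.16 with (2.48a)–(2.49), Cor 2.19, (2.24).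
* [Bei2014] F. Bei, arXiv:1401.2766, §1 p. 5 and Prop 1.4 (`𝓗^i ≅ H̄^i`, `𝓗^i ≅ H̄^{n−i}` of the dual complex, through
  `HilbertComplexHarmonicCohomology.lean` / `HilbertComplexDualFredholm.lean`).
* [ArnoldFalkWinther2010] D. N. Arnold, R. S. Falk, R. Winther, Bull. AMS 47 (2010), §3.1.3–§3.1.4 (harmonic forms,
  cochain maps, through `HilbertComplexMaps.lean`).
-/

noncomputable section

open scoped InnerProductSpace LinearPMap

namespace Literature.Analysis.InnerProduct

variable {𝕜 E F G E' F' G' : Type*} [RCLike 𝕜]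
variable [NormedAddCommGroup E] [InnerProductSpace 𝕜 E]
variable [NormedAddCommGroup F] [InnerProductSpace 𝕜 F]
variable [NormedAddCommGroup G] [InnerProductSpace 𝕜 G]
variable [NormedAddCommGroup E'] [InnerProductSpace 𝕜 E']
variable [NormedAddCommGroup F'] [InnerProductSpace 𝕜 F']
variable [NormedAddCommGroup G'] [InnerProductSpace 𝕜 G']

/-! ### §1 Corollary 2.19: isomorphic complexes have isomorphic `Ker T`, `Ker S / Im T`, `Ker S / cl Im T`, `𝔥`,
`G / Im S` -/

section Iso

variable {T : E →ₗ.[𝕜] F} {S : F →ₗ.[𝕜] G} {T' : E' →ₗ.[𝕜] F'} {S' : F' →ₗ.[𝕜] G'}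
variable {g_E : E →L[𝕜] E'} {g_F : F →L[𝕜] F'} {g_G : G →L[𝕜] G'}
  {k_E : E' →L[𝕜] E} {k_F : F' →L[𝕜] F} {k_G : G' →L[𝕜] G}

/-- **Degree `0`: an isomorphism of complexes restricts to `Ker T ≃ Ker T′`** (`g_E(Ker T) ⊆ Ker T′`,
`k_E(Ker T′) ⊆ Ker T`, mutually inverse). [cite: BruningLesch1992, §2 Cor 2.19 (with (2.7), Lemma 2.7)] -/
theorem nonempty_pmapKer_linearEquiv_of_iso
    (hgT : ∀ (w : E) (hw : w ∈ T.domain), ∃ h : g_E w ∈ T'.domain, T' ⟨g_E w, h⟩ = g_F (T ⟨w, hw⟩))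
    (hkT : ∀ (w' : E') (hw' : w' ∈ T'.domain), ∃ h : k_E w' ∈ T.domain, T ⟨k_E w', h⟩ = k_F (T' ⟨w', hw'⟩))
    (hkg_E : ∀ w : E, k_E (g_E w) = w) (hgk_E : ∀ w' : E', g_E (k_E w') = w') :
    Nonempty (↥((LinearMap.ker T.toFun).map T.domain.subtype) ≃ₗ[𝕜]
      ↥((LinearMap.ker T'.toFun).map T'.domain.subtype)) :=
  ⟨{ toFun := fun w ↦ ⟨g_E w, apply_mem_pmapKer_of_map hgT w.2⟩
     map_add' := fun _ _ ↦ Subtype.ext (map_add g_E _ _)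
     map_smul' := fun _ _ ↦ Subtype.ext (map_smul g_E _ _)
     invFun := fun w' ↦ ⟨k_E w', apply_mem_pmapKer_of_map hkT w'.2⟩
     left_inv := fun w ↦ Subtype.ext (hkg_E w)
     right_inv := fun w' ↦ Subtype.ext (hgk_E w') }⟩

/-- **Corollary 2.19, degree `0`: `dim Ker T = dim Ker T′`** for isomorphic complexes. [cite: BruningLesch1992, §2 Cor
2.19 ("any isomorphic Hilbert complex … has the same analytic and geometric Betti numbers")] -/
theorem finrank_pmapKer_eq_of_iso
    (hgT : ∀ (w : E) (hw : w ∈ T.domain), ∃ h : g_E w ∈ T'.domain, T' ⟨g_E w, h⟩ = g_F (T ⟨w, hw⟩))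
    (hkT : ∀ (w' : E') (hw' : w' ∈ T'.domain), ∃ h : k_E w' ∈ T.domain, T ⟨k_E w', h⟩ = k_F (T' ⟨w', hw'⟩))
    (hkg_E : ∀ w : E, k_E (g_E w) = w) (hgk_E : ∀ w' : E', g_E (k_E w') = w') :
    Module.finrank 𝕜 ((LinearMap.ker T.toFun).map T.domain.subtype) =
      Module.finrank 𝕜 ((LinearMap.ker T'.toFun).map T'.domain.subtype) := by
  obtain ⟨e⟩ := nonempty_pmapKer_linearEquiv_of_iso hgT hkT hkg_E hgk_E
  exact e.finrank_eq

/-- The identity `k_F ∘ g_F = id` is a homotopy with the zero homotopy operator: `(k ∘ g)_F u − u = T(0) + 0(Su)`.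
[cite: BruningLesch1992, §2 Definition 2.8 (2.27) with `A = 0`] -/
private theorem homotopy_zero_of_comp_eq (hkg_F : ∀ u : F, k_F (g_F u) = u) :
    ∀ (u : F) (hu : u ∈ S.domain), ∃ hA : (0 : F →ₗ[𝕜] E) u ∈ T.domain,
      (k_F.comp g_F) u - u = T ⟨(0 : F →ₗ[𝕜] E) u, hA⟩ + (0 : G →ₗ[𝕜] F) (S ⟨u, hu⟩) := by
  intro u hu
  have h0 : (0 : F →ₗ[𝕜] E) u ∈ T.domain := by rw [LinearMap.zero_apply]; exact T.domain.zero_mem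
  have hT0 : T ⟨(0 : F →ₗ[𝕜] E) u, h0⟩ = 0 := by
    have e0 : (⟨(0 : F →ₗ[𝕜] E) u, h0⟩ : T.domain) = 0 := Subtype.ext (LinearMap.zero_apply u)
    rw [e0, LinearPMap.map_zero]
  refine ⟨h0, ?_⟩
  rw [hT0, LinearMap.zero_apply, add_zero, ContinuousLinearMap.comp_apply, hkg_F, sub_self]

/-- **Degree `1`: an isomorphism of complexes induces a bijection `g_* : Ker S / Im T → Ker S′ / Im T′`** (a map
with an inverse map is a homotopy equivalence with zero homotopy operators). [cite: BruningLesch1992, §2 Cor 2.19,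
Lemma 2.9–2.10] -/
theorem cohomologyMap_bijective_of_iso
    (hgS : ∀ (u : F) (hu : u ∈ S.domain), ∃ h : g_F u ∈ S'.domain, S' ⟨g_F u, h⟩ = g_G (S ⟨u, hu⟩))
    (hkS : ∀ (u' : F') (hu' : u' ∈ S'.domain), ∃ h : k_F u' ∈ S.domain, S ⟨k_F u', h⟩ = k_G (S' ⟨u', hu'⟩))
    (hkg_F : ∀ u : F, k_F (g_F u) = u) (hgk_F : ∀ u' : F', g_F (k_F u') = u')
    {gq : (↥((LinearMap.ker S.toFun).map S.domain.subtype) ⧸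
        (LinearMap.range T.toFun).comap ((LinearMap.ker S.toFun).map S.domain.subtype).subtype) →ₗ[𝕜]
        (↥((LinearMap.ker S'.toFun).map S'.domain.subtype) ⧸
          (LinearMap.range T'.toFun).comap ((LinearMap.ker S'.toFun).map S'.domain.subtype).subtype)}
    (hg : ∀ (u : ↥((LinearMap.ker S.toFun).map S.domain.subtype))
        (h : g_F (u : F) ∈ (LinearMap.ker S'.toFun).map S'.domain.subtype),
        gq (((LinearMap.range T.toFun).comap ((LinearMap.ker S.toFun).map S.domain.subtype).subtype).mkQ u) =
          ((LinearMap.range T'.toFun).comap ((LinearMap.ker S'.toFun).map S'.domain.subtype).subtype).mkQ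
            ⟨g_F (u : F), h⟩)
    {kq : (↥((LinearMap.ker S'.toFun).map S'.domain.subtype) ⧸
        (LinearMap.range T'.toFun).comap ((LinearMap.ker S'.toFun).map S'.domain.subtype).subtype) →ₗ[𝕜]
        (↥((LinearMap.ker S.toFun).map S.domain.subtype) ⧸
          (LinearMap.range T.toFun).comap ((LinearMap.ker S.toFun).map S.domain.subtype).subtype)}
    (hk : ∀ (u' : ↥((LinearMap.ker S'.toFun).map S'.domain.subtype))
        (h : k_F (u' : F') ∈ (LinearMap.ker S.toFun).map S.domain.subtype),
        kq (((LinearMap.range T'.toFun).comap ((LinearMap.ker S'.toFun).map S'.domain.subtype).subtype).mkQ u') =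
          ((LinearMap.range T.toFun).comap ((LinearMap.ker S.toFun).map S.domain.subtype).subtype).mkQ
            ⟨k_F (u' : F'), h⟩) :
    Function.Bijective gq :=
  cohomologyMap_bijective_of_homotopyEquiv hgS hkS (homotopy_zero_of_comp_eq hkg_F) (homotopy_zero_of_comp_eq hgk_F)
    hg hk

/-- **Corollary 2.19, degree `1`: `dim (Ker S / Im T) = dim (Ker S′ / Im T′)`** for isomorphic complexes (the
geometric Betti number `p₁`). [cite: BruningLesch1992, §2 Cor 2.19] -/
theorem finrank_cohomology_eq_of_iso
    (hgT : ∀ (w : E) (hw : w ∈ T.domain), ∃ h : g_E w ∈ T'.domain, T' ⟨g_E w, h⟩ = g_F (T ⟨w, hw⟩))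
    (hgS : ∀ (u : F) (hu : u ∈ S.domain), ∃ h : g_F u ∈ S'.domain, S' ⟨g_F u, h⟩ = g_G (S ⟨u, hu⟩))
    (hkT : ∀ (w' : E') (hw' : w' ∈ T'.domain), ∃ h : k_E w' ∈ T.domain, T ⟨k_E w', h⟩ = k_F (T' ⟨w', hw'⟩))
    (hkS : ∀ (u' : F') (hu' : u' ∈ S'.domain), ∃ h : k_F u' ∈ S.domain, S ⟨k_F u', h⟩ = k_G (S' ⟨u', hu'⟩))
    (hkg_F : ∀ u : F, k_F (g_F u) = u) (hgk_F : ∀ u' : F', g_F (k_F u') = u') :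
    Module.finrank 𝕜 (↥((LinearMap.ker S.toFun).map S.domain.subtype) ⧸
        (LinearMap.range T.toFun).comap ((LinearMap.ker S.toFun).map S.domain.subtype).subtype) =
      Module.finrank 𝕜 (↥((LinearMap.ker S'.toFun).map S'.domain.subtype) ⧸
        (LinearMap.range T'.toFun).comap ((LinearMap.ker S'.toFun).map S'.domain.subtype).subtype) := by
  obtain ⟨gq, hg⟩ := exists_cohomologyMap hgT hgS
  obtain ⟨kq, hk⟩ := exists_cohomologyMap hkT hkS
  exact (LinearEquiv.ofBijective gq (cohomologyMap_bijective_of_iso hgS hkS hkg_F hgk_F hg hk)).finrank_eq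

/-- **An isomorphism of complexes induces a bijection `ḡ_* : Ker S / cl Im T → Ker S′ / cl Im T′`** on the reduced
cohomology (`k̄_* ∘ ḡ_* = (k ∘ g)‾_* = id` and symmetrically). [cite: BruningLesch1992, §2 Cor 2.19, Lemma 2.7] -/
theorem reducedCohomologyMap_bijective_of_iso
    (hgS : ∀ (u : F) (hu : u ∈ S.domain), ∃ h : g_F u ∈ S'.domain, S' ⟨g_F u, h⟩ = g_G (S ⟨u, hu⟩))
    (hkS : ∀ (u' : F') (hu' : u' ∈ S'.domain), ∃ h : k_F u' ∈ S.domain, S ⟨k_F u', h⟩ = k_G (S' ⟨u', hu'⟩))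
    (hkg_F : ∀ u : F, k_F (g_F u) = u) (hgk_F : ∀ u' : F', g_F (k_F u') = u')
    {gq : (↥((LinearMap.ker S.toFun).map S.domain.subtype) ⧸
        ((LinearMap.range T.toFun).topologicalClosure).comap
          ((LinearMap.ker S.toFun).map S.domain.subtype).subtype) →ₗ[𝕜]
        (↥((LinearMap.ker S'.toFun).map S'.domain.subtype) ⧸
          ((LinearMap.range T'.toFun).topologicalClosure).comap
            ((LinearMap.ker S'.toFun).map S'.domain.subtype).subtype)}
    (hg : ∀ (u : ↥((LinearMap.ker S.toFun).map S.domain.subtype))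
        (h : g_F (u : F) ∈ (LinearMap.ker S'.toFun).map S'.domain.subtype),
        gq ((((LinearMap.range T.toFun).topologicalClosure).comap
            ((LinearMap.ker S.toFun).map S.domain.subtype).subtype).mkQ u) =
          (((LinearMap.range T'.toFun).topologicalClosure).comap
            ((LinearMap.ker S'.toFun).map S'.domain.subtype).subtype).mkQ ⟨g_F (u : F), h⟩)
    {kq : (↥((LinearMap.ker S'.toFun).map S'.domain.subtype) ⧸
        ((LinearMap.range T'.toFun).topologicalClosure).comap
          ((LinearMap.ker S'.toFun).map S'.domain.subtype).subtype) →ₗ[𝕜]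
        (↥((LinearMap.ker S.toFun).map S.domain.subtype) ⧸
          ((LinearMap.range T.toFun).topologicalClosure).comap
            ((LinearMap.ker S.toFun).map S.domain.subtype).subtype)}
    (hk : ∀ (u' : ↥((LinearMap.ker S'.toFun).map S'.domain.subtype))
        (h : k_F (u' : F') ∈ (LinearMap.ker S.toFun).map S.domain.subtype),
        kq ((((LinearMap.range T'.toFun).topologicalClosure).comap
            ((LinearMap.ker S'.toFun).map S'.domain.subtype).subtype).mkQ u') =
          (((LinearMap.range T.toFun).topologicalClosure).comap
            ((LinearMap.ker S.toFun).map S.domain.subtype).subtype).mkQ ⟨k_F (u' : F'), h⟩) :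
    Function.Bijective gq := by
  have h1 : LinearMap.id = kq ∘ₗ gq :=
    reducedCohomologyMap_comp hgS hkS hg hk fun u _ ↦ by
      rw [LinearMap.id_apply]
      exact congrArg _ (Subtype.ext (show (u : F) = (k_F.comp g_F) u by rw [ContinuousLinearMap.comp_apply, hkg_F]))
  have h2 : LinearMap.id = gq ∘ₗ kq :=
    reducedCohomologyMap_comp hkS hgS hk hg fun u' _ ↦ by
      rw [LinearMap.id_apply]
      exact congrArg _ (Subtype.ext (show (u' : F') = (g_F.comp k_F) u' by rw [ContinuousLinearMap.comp_apply, hgk_F]))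
  exact Function.bijective_iff_has_inverse.2
    ⟨kq, fun q ↦ (LinearMap.congr_fun h1 q).symm, fun q' ↦ (LinearMap.congr_fun h2 q').symm⟩

/-- **`dim (Ker S / cl Im T) = dim (Ker S′ / cl Im T′)`** for isomorphic complexes. [cite: BruningLesch1992, §2 Cor
2.19] -/
theorem finrank_reducedCohomology_eq_of_iso
    (hgT : ∀ (w : E) (hw : w ∈ T.domain), ∃ h : g_E w ∈ T'.domain, T' ⟨g_E w, h⟩ = g_F (T ⟨w, hw⟩))
    (hgS : ∀ (u : F) (hu : u ∈ S.domain), ∃ h : g_F u ∈ S'.domain, S' ⟨g_F u, h⟩ = g_G (S ⟨u, hu⟩))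
    (hkT : ∀ (w' : E') (hw' : w' ∈ T'.domain), ∃ h : k_E w' ∈ T.domain, T ⟨k_E w', h⟩ = k_F (T' ⟨w', hw'⟩))
    (hkS : ∀ (u' : F') (hu' : u' ∈ S'.domain), ∃ h : k_F u' ∈ S.domain, S ⟨k_F u', h⟩ = k_G (S' ⟨u', hu'⟩))
    (hkg_F : ∀ u : F, k_F (g_F u) = u) (hgk_F : ∀ u' : F', g_F (k_F u') = u') :
    Module.finrank 𝕜 (↥((LinearMap.ker S.toFun).map S.domain.subtype) ⧸
        ((LinearMap.range T.toFun).topologicalClosure).comap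
          ((LinearMap.ker S.toFun).map S.domain.subtype).subtype) =
      Module.finrank 𝕜 (↥((LinearMap.ker S'.toFun).map S'.domain.subtype) ⧸
        ((LinearMap.range T'.toFun).topologicalClosure).comap
          ((LinearMap.ker S'.toFun).map S'.domain.subtype).subtype) := by
  obtain ⟨gq, hg⟩ := exists_reducedCohomologyMap hgT hgS
  obtain ⟨kq, hk⟩ := exists_reducedCohomologyMap hkT hkS
  exact (LinearEquiv.ofBijective gq (reducedCohomologyMap_bijective_of_iso hgS hkS hkg_F hgk_F hg hk)).finrank_eq

/-- **Corollary 2.19 for the analytic Betti number: `dim 𝔥 = dim 𝔥′` for isomorphic complexes** ("the dimension of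
`𝓗̂_i` is invariant under complex isomorphisms"; `𝔥 ≅ Ker S / cl Im T ≅ Ker S′ / cl Im T′ ≅ 𝔥′`).
[cite: BruningLesch1992, §2 Lemma 2.7 ("In particular, the dimension of `𝓗̂_i` is invariant under complex
isomorphisms"), Cor 2.19, (2.24); Bei2014, §1 p. 5] -/
theorem finrank_harmonic_eq_of_iso [CompleteSpace E] [CompleteSpace F] [CompleteSpace E'] [CompleteSpace F']
    (hdT : Dense (T.domain : Set E)) (hcS : S.IsClosed)
    (hST : LinearMap.range T.toFun ≤ (LinearMap.ker S.toFun).map S.domain.subtype)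
    (hdT' : Dense (T'.domain : Set E')) (hcS' : S'.IsClosed)
    (hST' : LinearMap.range T'.toFun ≤ (LinearMap.ker S'.toFun).map S'.domain.subtype)
    (hgT : ∀ (w : E) (hw : w ∈ T.domain), ∃ h : g_E w ∈ T'.domain, T' ⟨g_E w, h⟩ = g_F (T ⟨w, hw⟩))
    (hgS : ∀ (u : F) (hu : u ∈ S.domain), ∃ h : g_F u ∈ S'.domain, S' ⟨g_F u, h⟩ = g_G (S ⟨u, hu⟩))
    (hkT : ∀ (w' : E') (hw' : w' ∈ T'.domain), ∃ h : k_E w' ∈ T.domain, T ⟨k_E w', h⟩ = k_F (T' ⟨w', hw'⟩))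
    (hkS : ∀ (u' : F') (hu' : u' ∈ S'.domain), ∃ h : k_F u' ∈ S.domain, S ⟨k_F u', h⟩ = k_G (S' ⟨u', hu'⟩))
    (hkg_F : ∀ u : F, k_F (g_F u) = u) (hgk_F : ∀ u' : F', g_F (k_F u') = u') :
    Module.finrank 𝕜 ↥((LinearMap.ker S.toFun).map S.domain.subtype ⊓ (LinearMap.ker T†.toFun).map T†.domain.subtype) =
      Module.finrank 𝕜
        ↥((LinearMap.ker S'.toFun).map S'.domain.subtype ⊓ (LinearMap.ker T'†.toFun).map T'†.domain.subtype) := by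
  rw [(LinearEquiv.ofBijective _ (bijective_mkQ_comp_inclusion_harmonic hdT hcS hST)).finrank_eq,
    (LinearEquiv.ofBijective _ (bijective_mkQ_comp_inclusion_harmonic hdT' hcS' hST')).finrank_eq]
  exact finrank_reducedCohomology_eq_of_iso hgT hgS hkT hkS hkg_F hgk_F

/-- **(2.49)-type statement: for an isomorphism of complexes, `ĝ = P_{𝔥′} ∘ g_F : 𝔥 → 𝔥′` is bijective**
(`k̂ ∘ ĝ = (k ∘ g)^ = id^ = id` and symmetrically, Lemma 2.7). [cite: BruningLesch1992, §2 Lemma 2.7, Lemma 2.16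
(2.49), Cor 2.19] -/
theorem harmonicMap_bijective_of_iso [CompleteSpace E] [CompleteSpace F] [CompleteSpace E'] [CompleteSpace F']
    (hdT : Dense (T.domain : Set E)) (hcS : S.IsClosed)
    (hST : LinearMap.range T.toFun ≤ (LinearMap.ker S.toFun).map S.domain.subtype)
    (hdT' : Dense (T'.domain : Set E')) (hcS' : S'.IsClosed)
    (hST' : LinearMap.range T'.toFun ≤ (LinearMap.ker S'.toFun).map S'.domain.subtype)
    (hgT : ∀ (w : E) (hw : w ∈ T.domain), ∃ h : g_E w ∈ T'.domain, T' ⟨g_E w, h⟩ = g_F (T ⟨w, hw⟩))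
    (hgS : ∀ (u : F) (hu : u ∈ S.domain), ∃ h : g_F u ∈ S'.domain, S' ⟨g_F u, h⟩ = g_G (S ⟨u, hu⟩))
    (hkT : ∀ (w' : E') (hw' : w' ∈ T'.domain), ∃ h : k_E w' ∈ T.domain, T ⟨k_E w', h⟩ = k_F (T' ⟨w', hw'⟩))
    (hkS : ∀ (u' : F') (hu' : u' ∈ S'.domain), ∃ h : k_F u' ∈ S.domain, S ⟨k_F u', h⟩ = k_G (S' ⟨u', hu'⟩))
    (hkg_F : ∀ u : F, k_F (g_F u) = u) (hgk_F : ∀ u' : F', g_F (k_F u') = u')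
    [((LinearMap.ker S.toFun).map S.domain.subtype ⊓
      (LinearMap.ker T†.toFun).map T†.domain.subtype).HasOrthogonalProjection]
    [((LinearMap.ker S'.toFun).map S'.domain.subtype ⊓
      (LinearMap.ker T'†.toFun).map T'†.domain.subtype).HasOrthogonalProjection] :
    Function.Bijective (((LinearMap.ker S'.toFun).map S'.domain.subtype ⊓
        (LinearMap.ker T'†.toFun).map T'†.domain.subtype).orthogonalProjectionOnto.comp
      (g_F.comp ((LinearMap.ker S.toFun).map S.domain.subtype ⊓
        (LinearMap.ker T†.toFun).map T†.domain.subtype).subtypeL)) := by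
  have hkg : k_F.comp g_F = ContinuousLinearMap.id 𝕜 F := ContinuousLinearMap.ext hkg_F
  have hgk : g_F.comp k_F = ContinuousLinearMap.id 𝕜 F' := ContinuousLinearMap.ext hgk_F
  have h1 := harmonicMap_comp (T := T) (S'' := S) hdT' hcS' hST' hdT hgS hkT
  rw [hkg, harmonicMap_id] at h1
  have h2 := harmonicMap_comp (T := T') (S'' := S') hdT hcS hST hdT' hkS hgT
  rw [hgk, harmonicMap_id] at h2
  refine Function.bijective_iff_has_inverse.2 ⟨((LinearMap.ker S.toFun).map S.domain.subtype ⊓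
      (LinearMap.ker T†.toFun).map T†.domain.subtype).orthogonalProjectionOnto.comp
    (k_F.comp ((LinearMap.ker S'.toFun).map S'.domain.subtype ⊓
      (LinearMap.ker T'†.toFun).map T'†.domain.subtype).subtypeL), fun x ↦ ?_, fun x' ↦ ?_⟩
  · have := ContinuousLinearMap.ext_iff.1 h1 x
    rw [ContinuousLinearMap.id_apply, ContinuousLinearMap.comp_apply] at this
    exact this.symm
  · have := ContinuousLinearMap.ext_iff.1 h2 x'
    rw [ContinuousLinearMap.id_apply, ContinuousLinearMap.comp_apply] at this
    exact this.symm

/-- **Degree `2`: an isomorphism of complexes induces a bijection `G / Im S → G′ / Im S′`.** [cite: BruningLesch1992, §2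
Cor 2.19] -/
theorem quotientRangeMap_bijective_of_iso
    (hkg_G : ∀ y : G, k_G (g_G y) = y) (hgk_G : ∀ y' : G', g_G (k_G y') = y')
    {gq : (G ⧸ LinearMap.range S.toFun) →ₗ[𝕜] (G' ⧸ LinearMap.range S'.toFun)}
    (hg : ∀ y : G, gq ((LinearMap.range S.toFun).mkQ y) = (LinearMap.range S'.toFun).mkQ (g_G y))
    {kq : (G' ⧸ LinearMap.range S'.toFun) →ₗ[𝕜] (G ⧸ LinearMap.range S.toFun)}
    (hk : ∀ y' : G', kq ((LinearMap.range S'.toFun).mkQ y') = (LinearMap.range S.toFun).mkQ (k_G y')) :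
    Function.Bijective gq := by
  have h1 : LinearMap.id = kq ∘ₗ gq :=
    quotientRangeMap_comp hg hk fun y ↦ by rw [LinearMap.id_apply, ContinuousLinearMap.comp_apply, hkg_G]
  have h2 : LinearMap.id = gq ∘ₗ kq :=
    quotientRangeMap_comp hk hg fun y' ↦ by rw [LinearMap.id_apply, ContinuousLinearMap.comp_apply, hgk_G]
  exact Function.bijective_iff_has_inverse.2
    ⟨kq, fun q ↦ (LinearMap.congr_fun h1 q).symm, fun q' ↦ (LinearMap.congr_fun h2 q').symm⟩

/-- **Corollary 2.19, degree `2`: `dim (G / Im S) = dim (G′ / Im S′)`** for isomorphic complexes.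
[cite: BruningLesch1992, §2 Cor 2.19] -/
theorem finrank_quotient_range_eq_of_iso
    (hgS : ∀ (u : F) (hu : u ∈ S.domain), ∃ h : g_F u ∈ S'.domain, S' ⟨g_F u, h⟩ = g_G (S ⟨u, hu⟩))
    (hkS : ∀ (u' : F') (hu' : u' ∈ S'.domain), ∃ h : k_F u' ∈ S.domain, S ⟨k_F u', h⟩ = k_G (S' ⟨u', hu'⟩))
    (hkg_G : ∀ y : G, k_G (g_G y) = y) (hgk_G : ∀ y' : G', g_G (k_G y') = y') :
    Module.finrank 𝕜 (G ⧸ LinearMap.range S.toFun) = Module.finrank 𝕜 (G' ⧸ LinearMap.range S'.toFun) := by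
  obtain ⟨gq, hg⟩ := exists_quotientRangeMap hgS
  obtain ⟨kq, hk⟩ := exists_quotientRangeMap hkS
  exact (LinearEquiv.ofBijective gq (quotientRangeMap_bijective_of_iso hkg_G hgk_G hg hk)).finrank_eq

end Iso

/-! ### §2 Lemma 2.16: Poincaré duality — an isomorphism onto the dual complex `0 → G →S* F →T* E → 0` -/

section PoincareDuality

variable [CompleteSpace E] [CompleteSpace F] [CompleteSpace G]
variable {T : E →ₗ.[𝕜] F} {S : F →ₗ.[𝕜] G}
variable {g₀ : E →L[𝕜] G} {g₁ : F →L[𝕜] F} {g₂ : G →L[𝕜] E} {k₀ : G →L[𝕜] E} {k₁ : F →L[𝕜] F} {k₂ : E →L[𝕜] G}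

omit [CompleteSpace E] [CompleteSpace G] in
/-- **(2.49) in degree `0`: Poincaré duality data carry `𝓗̂_0 = Ker T` into `𝓗̂*_0 = Ker S* = 𝓗̂_2`**
(`S*(g₀ w) = g₁(Tw) = 0`). [cite: BruningLesch1992, §2 Lemma 2.16 (2.48b), (2.49) with (2.8b)] -/
theorem apply_mem_pmapKer_adjoint_of_poincareDuality
    (hg₀ : ∀ (w : E) (hw : w ∈ T.domain), ∃ h : g₀ w ∈ S†.domain, S† ⟨g₀ w, h⟩ = g₁ (T ⟨w, hw⟩))
    {w : E} (hw : w ∈ (LinearMap.ker T.toFun).map T.domain.subtype) :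
    g₀ w ∈ (LinearMap.ker S†.toFun).map S†.domain.subtype :=
  apply_mem_pmapKer_of_map hg₀ hw

omit [CompleteSpace E] [CompleteSpace G] in
/-- **Lemma 2.16, degree `0`/`2`: a Poincaré duality isomorphism gives `dim Ker T = dim Ker S*`** (`𝓗̂_0 ≅ 𝓗̂*_0 =
𝓗̂_2`). [cite: BruningLesch1992, §2 Lemma 2.16 (2.49) ("`g` induces isomorphisms `ĝ_i : 𝓗̂_i → 𝓗̂_{N−i}`")] -/
theorem finrank_pmapKer_eq_finrank_pmapKer_adjoint_of_poincareDuality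
    (hg₀ : ∀ (w : E) (hw : w ∈ T.domain), ∃ h : g₀ w ∈ S†.domain, S† ⟨g₀ w, h⟩ = g₁ (T ⟨w, hw⟩))
    (hk₀ : ∀ (z : G) (hz : z ∈ S†.domain), ∃ h : k₀ z ∈ T.domain, T ⟨k₀ z, h⟩ = k₁ (S† ⟨z, hz⟩))
    (hkg₀ : ∀ w : E, k₀ (g₀ w) = w) (hgk₀ : ∀ z : G, g₀ (k₀ z) = z) :
    Module.finrank 𝕜 ((LinearMap.ker T.toFun).map T.domain.subtype) =
      Module.finrank 𝕜 ((LinearMap.ker S†.toFun).map S†.domain.subtype) :=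
  finrank_pmapKer_eq_of_iso hg₀ hk₀ hkg₀ hgk₀

omit [CompleteSpace E] in
/-- **Lemma 2.16, last assertion ("`g_{i*} : H_i → H_{N−i}`" in the Fredholm case): `p₀ = p₂`** — for a Poincaré
duality isomorphism and `Im S` closed, `dim Ker T = dim (G / Im S)` (`Ker T ≅ Ker S* = (Im S)^⊥ ≅ G / Im S`).
[cite: BruningLesch1992, §2 Lemma 2.16 ("If, moreover, `(𝒟, D)` is Fredholm `g` induces also isomorphisms
`g_{i*} : H_i → H_{N−i}`"), Cor 2.6] -/
theorem finrank_pmapKer_eq_finrank_quotient_range_of_poincareDuality (hdS : Dense (S.domain : Set F))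
    (hRS : IsClosed ((LinearMap.range S.toFun : Submodule 𝕜 G) : Set G))
    (hg₀ : ∀ (w : E) (hw : w ∈ T.domain), ∃ h : g₀ w ∈ S†.domain, S† ⟨g₀ w, h⟩ = g₁ (T ⟨w, hw⟩))
    (hk₀ : ∀ (z : G) (hz : z ∈ S†.domain), ∃ h : k₀ z ∈ T.domain, T ⟨k₀ z, h⟩ = k₁ (S† ⟨z, hz⟩))
    (hkg₀ : ∀ w : E, k₀ (g₀ w) = w) (hgk₀ : ∀ z : G, g₀ (k₀ z) = z) :
    Module.finrank 𝕜 ((LinearMap.ker T.toFun).map T.domain.subtype) =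
      Module.finrank 𝕜 (G ⧸ LinearMap.range S.toFun) := by
  rw [finrank_pmapKer_eq_finrank_pmapKer_adjoint_of_poincareDuality hg₀ hk₀ hkg₀ hgk₀,
    finrank_pmapKer_adjoint_eq_finrank_quotient_range hdS hRS]

/-- **(2.49) in the middle degree: for a Poincaré duality isomorphism, `ĝ₁ = P ∘ g₁ : 𝔥 → 𝓗̂*_1` is bijective**, where
`𝓗̂*_1 = Ker T* ∩ Ker S**` is the harmonic space of the dual complex (`= 𝔥`, `harmonic_dual_eq`).
[cite: BruningLesch1992, §2 Lemma 2.16 (2.49), Lemma 2.7, (2.8b)] -/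
theorem harmonicMap_bijective_of_poincareDuality (hdT : Dense (T.domain : Set E))
    (hdS : Dense (S.domain : Set F)) (hcS : S.IsClosed)
    (hST : LinearMap.range T.toFun ≤ (LinearMap.ker S.toFun).map S.domain.subtype)
    (hg₀ : ∀ (w : E) (hw : w ∈ T.domain), ∃ h : g₀ w ∈ S†.domain, S† ⟨g₀ w, h⟩ = g₁ (T ⟨w, hw⟩))
    (hg₁ : ∀ (u : F) (hu : u ∈ S.domain), ∃ h : g₁ u ∈ T†.domain, T† ⟨g₁ u, h⟩ = g₂ (S ⟨u, hu⟩))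
    (hk₀ : ∀ (z : G) (hz : z ∈ S†.domain), ∃ h : k₀ z ∈ T.domain, T ⟨k₀ z, h⟩ = k₁ (S† ⟨z, hz⟩))
    (hk₁ : ∀ (u : F) (hu : u ∈ T†.domain), ∃ h : k₁ u ∈ S.domain, S ⟨k₁ u, h⟩ = k₂ (T† ⟨u, hu⟩))
    (hkg₁ : ∀ u : F, k₁ (g₁ u) = u) (hgk₁ : ∀ u : F, g₁ (k₁ u) = u)
    [((LinearMap.ker S.toFun).map S.domain.subtype ⊓
      (LinearMap.ker T†.toFun).map T†.domain.subtype).HasOrthogonalProjection]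
    [((LinearMap.ker T†.toFun).map T†.domain.subtype ⊓
      (LinearMap.ker S††.toFun).map S††.domain.subtype).HasOrthogonalProjection] :
    Function.Bijective (((LinearMap.ker T†.toFun).map T†.domain.subtype ⊓
        (LinearMap.ker S††.toFun).map S††.domain.subtype).orthogonalProjectionOnto.comp
      (g₁.comp ((LinearMap.ker S.toFun).map S.domain.subtype ⊓
        (LinearMap.ker T†.toFun).map T†.domain.subtype).subtypeL)) :=
  harmonicMap_bijective_of_iso (T' := S†) (S' := T†) hdT hcS hST (dense_adjoint_domain_of_isClosed hdS hcS)
    (LinearPMap.adjoint_isClosed hdT) (range_adjoint_le_pmapKer_adjoint hdS hST) hg₀ hg₁ hk₀ hk₁ hkg₁ hgk₁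

/-- **Poincaré duality, unitary case: `g₁(𝔥) = 𝔥`** — if the middle map `g₁` preserves inner products and carries
`Ker S` onto `Ker T*` and `cl Im T` onto `cl Im S*` (as the middle component of a unitary isomorphism onto the dual
complex does), then it maps the harmonic space `𝔥 = Ker S ∩ Ker T*` onto itself ("if `g_i` is unitary …
`g_i(𝓗̂_i) = 𝓗̂′_i`" with `𝓗̂′_1 = 𝓗̂*_1 = 𝓗̂_1`). [cite: BruningLesch1992, §2 Lemma 2.7 (unitary clause), Lemma 2.16
(2.49), (2.8b)] -/
theorem map_harmonic_eq_harmonic_of_poincareDuality (hdT : Dense (T.domain : Set E))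
    (hdS : Dense (S.domain : Set F)) (hcS : S.IsClosed)
    (hiso : ∀ x y : F, ⟪g₁ x, g₁ y⟫_𝕜 = ⟪x, y⟫_𝕜)
    (hK : ((LinearMap.ker S.toFun).map S.domain.subtype).map (g₁ : F →ₗ[𝕜] F) =
      (LinearMap.ker T†.toFun).map T†.domain.subtype)
    (hR : ((LinearMap.range T.toFun).topologicalClosure).map (g₁ : F →ₗ[𝕜] F) =
      (LinearMap.range S†.toFun).topologicalClosure) :
    ((LinearMap.ker S.toFun).map S.domain.subtype ⊓ (LinearMap.ker T†.toFun).map T†.domain.subtype).map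
        (g₁ : F →ₗ[𝕜] F) =
      (LinearMap.ker S.toFun).map S.domain.subtype ⊓ (LinearMap.ker T†.toFun).map T†.domain.subtype := by
  rw [map_harmonic_eq_of_inner_map (T' := S†) (S' := T†) hdT (dense_adjoint_domain_of_isClosed hdS hcS) hiso hK hR,
    harmonic_dual_eq hdS hcS]

end PoincareDuality

end Literature.Analysis.InnerProduct
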